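/-
Copyright (c) 2026 the pub-hodgecm-mathlib formalisation cell (harness21).  Prover seat hodgecm-mathlib-K2Liu-p06 (g2): Track B «K2-LIT»,
#184♮ = hLiu418 = stmt-HodgeConjecture-24832; organ file 1∕2 for socket #33w `sig_K2LiuThetaTypeContinuousVector` of the tier-1 socket module
`Cruxes/HLiu418/Lines/K2_Liu_CurveThetaSigs_U5d_ZetaS.lean` (ED. 1; planner K2Liu-plan (g2), LEAD F0P6-plan (g10) GO + DEAL 2026-09-04T01:42:07Z); 2026-09-04.
-/
import Literature.NumberTheory.Automorphic.AutomorphicSpectrumProofs      -- ★ `isStronglyContinuous_rightRegular_holds`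
import Literature.NumberTheory.Automorphic.InvariantMeasureDomination     -- ★ `orbitalSmoothing`, `continuous_orbitalSmoothing`, `coeFn_integral_smul_domSMul_ae_eq`
import Literature.NumberTheory.Automorphic.CompactSubgroupAveraging       -- ★ `exists_continuous_invariant_nonneg_pos`
import HarnessLib

/-!
# Crux `HLiu418`, Track B road `K2_Liu`, unit U5d «`Z_S`», socket #33w — organ 1∕2:
# smoothing an `L²` automorphic vector by a `C_c` weight, for a GENERAL adelic group datum

Cell `hodgecm-mathlib`, crux item hLiu418 = `stmt-HodgeConjecture-24832`, route of record `HCCMUnconditional`; squad K2 ∕ K2Liu,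
LEAD F0P6-plan (g10), planner K2Liu-plan (g2), prover K2Liu-p06 (g2).  THEOREMS ONLY (no `def`, no instance, no notation, no
named-fact hypothesis, no `sorry`, default heartbeats); lane `--supports stmt-HodgeConjecture-24832` (count-neutral helper).

WHAT IS PROVED.  The tree's `GL_n` smoothing kit ★ `SmoothedAutomorphicForms` (F4 of the `GL_n` cuspidal programme) re-run for an ARBITRARY
adelic group datum `𝒢` with `G(𝔸_K)` locally compact, second countable and Borel-measurable, an automorphic measure `μ` on
`X = G(𝔸_K) ⧸ A_G G(K)`, a Haar measure `ν` on `G(𝔸_K)` and a closed subrepresentation `W ≤ L²(X, μ)` of the regular representation `R`.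
For a real weight `η ∈ C_c(G(𝔸_K))` and `f ∈ W` the SMOOTHED VECTOR is the Bochner integral `∫ η(g) • (R(g) f) dν(g)` computed in the
(complete) space `W`; we prove, writing it always as that explicit integral (no definition is introduced):
* `continuous_toContRep_apply` ∕ `integrable_weight_smul_toContRep` — strong continuity of `R|_W` (★ `isStronglyContinuous_rightRegular_holds`;
  unitarity is ★ `isUnitary_toContRep`, not restated) and Bochner integrability of the integrand;
* `coe_integral_weight_smul_toContRep` — in `L²` it is `∫ η(g) • R(g) f dν`; `integral_weight_smul_toContRep_ae_eq_orbitalSmoothing` — it is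
  REPRESENTED by the orbital smoothing `S_η f (x) = ∫ η(g) f(g⁻¹ • x) dν(g)` (★ `coeFn_integral_smul_domSMul_ae_eq`), which is CONTINUOUS on `X`
  (`continuous_orbitalSmoothing_coe`, ★ `continuous_orbitalSmoothing`: the orbit map of the base point is the open quotient map);
* `toContRep_integral_weight_smul_eq_self` — for `η` left-`Kf`-invariant the smoothed vector is `Kf`-fixed (left invariance of `ν`);
* `exists_weight_integral_smul_toContRep_ne_zero` — NON-VANISHING SMOOTHINGS WITH PRESCRIBED SUPPORT: for a compact subgroup `Kf`, a non-zero
  `Kf`-fixed `f ∈ W` and ANY open `U ⊇ Kf` there is a continuous compactly supported `η ≥ 0`, left-`Kf`-invariant, supported in `U`, whose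
  smoothed vector is non-zero (★ `exists_continuous_invariant_nonneg_pos` on `U ∩ {g | Re ⟪f, R(g) f⟫ > ‖f‖²∕2}`, then
  `Re ⟪f, ∫ η R f⟫ ≥ (‖f‖²∕2) ∫ η > 0`).
Organ 2∕2 (`Theorems/K2LiuThetaTypeContinuousVector.lean`) specialises to `U(J)` and adds the Hecke transfer at the places off `S`.

HONEST LABEL.  Count-neutral scaffold file of the K2_Liu road; it pays nothing by itself: `HC_CM` is proved only modulo the 7 printed citations
(2 remaining named inputs: hLiu418 = `stmt-HodgeConjecture-24832`, h413 = `stmt-HodgeConjecture-24833`) until rung 0 closes.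

## References
* [BorelJacquet1979] A. Borel, H. Jacquet, *Automorphic forms and automorphic representations*, PSPM 33.1 (1979): §4.6 (the regular
  representation on `L²` and its integrated form).
* [Folland1995] G. B. Folland, *A Course in Abstract Harmonic Analysis* (1995): §3.1–3.2 (`π(f) = ∫ f(x) π(x) dx`), Prop. 2.41.
* [DeitmarEchterhoff2014] A. Deitmar, S. Echterhoff, *Principles of Harmonic Analysis*, 2nd ed. (2014): Prop. 6.2.1, Lemma 9.2.6.
-/

set_option autoImplicit false
set_option linter.dupNamespace false

noncomputable section

open scoped InnerProductSpace
open MeasureTheory Measure Filter Topology Set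
open Literature.NumberTheory.Automorphic

namespace Summit.HodgeConjecture.HodgeConjecture.Cruxes.HLiu418.K2LiuAutomorphicVectorSmoothing

universe u

variable {K : Type} [Field K] [NumberField K] (𝒢 : AdelicGroupData.{u} K)
  [LocallyCompactSpace 𝒢.Adelic] [SecondCountableTopology 𝒢.Adelic]
  [MeasurableSpace 𝒢.Adelic] [BorelSpace 𝒢.Adelic]
  {μ : Measure 𝒢.automorphicQuotient} [𝒢.IsAutomorphicMeasure μ]
  (ν : Measure 𝒢.Adelic) [ν.IsHaarMeasure]
  (W : ContRepresentation.ClosedSubrep (𝒢.rightRegular μ))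

/-! ## §1  The orbit map of the base point `x₀ = [1]` -/

omit [LocallyCompactSpace 𝒢.Adelic] [SecondCountableTopology 𝒢.Adelic] [MeasurableSpace 𝒢.Adelic] [BorelSpace 𝒢.Adelic] in
/-- The orbit map `g ↦ g • [1]` of the base point of `G(𝔸_K) ⧸ A_G G(K)` is open (it is the quotient map). [folklore] -/
theorem isOpenMap_smul_base : IsOpenMap fun g : 𝒢.Adelic => g • 𝒢.toAutomorphicQuotient 1 :=
  isOpenMap_smul_quotient _ _

omit [LocallyCompactSpace 𝒢.Adelic] [SecondCountableTopology 𝒢.Adelic] [MeasurableSpace 𝒢.Adelic] [BorelSpace 𝒢.Adelic] in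
/-- The orbit map of the base point is continuous. [folklore] -/
theorem continuous_smul_base : Continuous fun g : 𝒢.Adelic => g • 𝒢.toAutomorphicQuotient 1 :=
  continuous_smul_quotient _ _

omit [LocallyCompactSpace 𝒢.Adelic] [SecondCountableTopology 𝒢.Adelic] [MeasurableSpace 𝒢.Adelic] [BorelSpace 𝒢.Adelic] in
/-- The orbit map of the base point is surjective. [folklore] -/
theorem surjective_smul_base : Function.Surjective fun g : 𝒢.Adelic => g • 𝒢.toAutomorphicQuotient 1 :=
  surjective_smul_quotient _ _

/-! ## §2  The smoothed vector `∫ η(g) • R(g) f dν(g)` in a closed subrepresentation `W ≤ L²` -/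

omit [LocallyCompactSpace 𝒢.Adelic] [SecondCountableTopology 𝒢.Adelic] [MeasurableSpace 𝒢.Adelic] [BorelSpace 𝒢.Adelic] in
/-- Strong continuity of the regular representation restricted to a closed subrepresentation of `L²(X, μ)`
(★ `isStronglyContinuous_rightRegular_holds`). [cite: BorelJacquet1979, §4.6] -/
theorem continuous_toContRep_apply (f : W.toSubmodule) : Continuous fun g : 𝒢.Adelic => W.toContRep g f := by
  refine continuous_induced_rng.2 ?_
  change Continuous fun g : 𝒢.Adelic => (𝒢.rightRegular μ g (f : 𝒢.L2 μ))
  exact (𝒢.isStronglyContinuous_rightRegular_holds μ) _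

omit [LocallyCompactSpace 𝒢.Adelic] [SecondCountableTopology 𝒢.Adelic] in
/-- The integrand `η(g) • R(g) f` of the smoothed vector is Bochner integrable for a continuous compactly supported real weight `η`
and a measure finite on compact sets. [cite: DeitmarEchterhoff2014, Prop. 6.2.1] -/
theorem integrable_weight_smul_toContRep {η : 𝒢.Adelic → ℝ} (hη : Continuous η)
    (hηs : HasCompactSupport η) (f : W.toSubmodule) :
    Integrable (fun g => (η g : ℂ) • W.toContRep g f) ν := by
  refine Continuous.integrable_of_hasCompactSupport ?_ ?_
  · exact (Complex.continuous_ofReal.comp hη).smul (continuous_toContRep_apply 𝒢 W f)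
  · exact (hηs.comp_left Complex.ofReal_zero).smul_right

omit [LocallyCompactSpace 𝒢.Adelic] [SecondCountableTopology 𝒢.Adelic] in
/-- In `L²`, the smoothed vector is the Bochner integral of the translates `η(g) • R(g) f` (the inclusion `W ↪ L²` is a continuous linear
map and commutes with the integral). [cite: Folland1995, §3.2] -/
theorem coe_integral_weight_smul_toContRep {η : 𝒢.Adelic → ℝ} (hη : Continuous η)
    (hηs : HasCompactSupport η) (f : W.toSubmodule) :
    ((∫ g, (η g : ℂ) • W.toContRep g f ∂ν : W.toSubmodule) : 𝒢.L2 μ) =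
      ∫ g, (η g : ℂ) • 𝒢.rightRegular μ g (f : 𝒢.L2 μ) ∂ν := by
  rw [← Submodule.subtypeL_apply, ← ContinuousLinearMap.integral_comp_comm _ (integrable_weight_smul_toContRep 𝒢 ν W hη hηs f)]
  rfl

/-- **The smoothed vector is represented by the orbital smoothing** `S_η f (x) = ∫ η(g) f(g⁻¹ • x) dν(g)`
(★ `coeFn_integral_smul_domSMul_ae_eq`). [cite: Folland1995, §3.2] -/
theorem integral_weight_smul_toContRep_ae_eq_orbitalSmoothing {η : 𝒢.Adelic → ℝ} (hη : Continuous η)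
    (hηs : HasCompactSupport η) (f : W.toSubmodule) :
    (((∫ g, (η g : ℂ) • W.toContRep g f ∂ν : W.toSubmodule) : 𝒢.L2 μ) : 𝒢.automorphicQuotient → ℂ) =ᵐ[μ]
      orbitalSmoothing ν (fun g => (η g : ℂ)) ((f : 𝒢.L2 μ) : 𝒢.automorphicQuotient → ℂ) := by
  rw [coe_integral_weight_smul_toContRep 𝒢 ν W hη hηs f]
  simp only [AdelicGroupData.rightRegular_apply]
  have hF : AEStronglyMeasurable (fun g : 𝒢.Adelic => (DomMulAct.mk g⁻¹ • (f : 𝒢.L2 μ) : 𝒢.L2 μ)) ν := by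
    have := (𝒢.isStronglyContinuous_rightRegular_holds μ) (f : 𝒢.L2 μ)
    simp only [AdelicGroupData.rightRegular_apply] at this
    exact this.aestronglyMeasurable
  exact coeFn_integral_smul_domSMul_ae_eq μ ν (Complex.continuous_ofReal.comp hη) (hηs.comp_left Complex.ofReal_zero) _ hF

/-- **The orbital smoothing of an `L²` class by a `C_c` weight is continuous** on the automorphic quotient (★ `continuous_orbitalSmoothing`
at the base point `[1]`, whose orbit map is the open continuous surjective quotient map; `L² ⊆ L¹` on the finite measure `μ`).
[cite: BorelJacquet1979, §4.6] -/
theorem continuous_orbitalSmoothing_coe {η : 𝒢.Adelic → ℝ} (hη : Continuous η) (hηs : HasCompactSupport η) (f : 𝒢.L2 μ) :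
    Continuous (orbitalSmoothing ν (fun g => (η g : ℂ)) (f : 𝒢.automorphicQuotient → ℂ)) :=
  continuous_orbitalSmoothing μ ν (isOpenMap_smul_base 𝒢) (surjective_smul_base 𝒢) (continuous_smul_base 𝒢)
    (Complex.continuous_ofReal.comp hη) (hηs.comp_left Complex.ofReal_zero) ((Lp.memLp f).integrable one_le_two)

omit [LocallyCompactSpace 𝒢.Adelic] [SecondCountableTopology 𝒢.Adelic] in
/-- **The smoothed vector by a left-`Kf`-invariant weight is `Kf`-fixed**: `R(k) ∫ η(g) R(g) f dν = ∫ η(k⁻¹ g) R(g) f dν` by left invariance of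
`ν`. [cite: BorelJacquet1979, §4.6] -/
theorem toContRep_integral_weight_smul_eq_self {η : 𝒢.Adelic → ℝ}
    (hη : Continuous η) (hηs : HasCompactSupport η) {Kf : Subgroup 𝒢.Adelic} (hηK : ∀ k ∈ Kf, ∀ g, η (k * g) = η g)
    (f : W.toSubmodule) {k : 𝒢.Adelic} (hk : k ∈ Kf) :
    W.toContRep k (∫ g, (η g : ℂ) • W.toContRep g f ∂ν) = ∫ g, (η g : ℂ) • W.toContRep g f ∂ν := by
  rw [← ContinuousLinearMap.integral_comp_comm _ (integrable_weight_smul_toContRep 𝒢 ν W hη hηs f)]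
  change ∫ g, W.toContRep k ((η g : ℂ) • W.toContRep g f) ∂ν = _
  have h1 : (fun g => W.toContRep k ((η g : ℂ) • W.toContRep g f)) =
      fun g => (fun g' => (η (k⁻¹ * g') : ℂ) • W.toContRep g' f) (k * g) := by
    funext g
    simp only [map_smul, inv_mul_cancel_left]
    rw [map_mul]
    rfl
  rw [h1, integral_mul_left_eq_self (μ := ν) (fun g' => (η (k⁻¹ * g') : ℂ) • W.toContRep g' f) k]
  congr 1 with g
  rw [hηK k⁻¹ (Kf.inv_mem hk) g]

/-- **Non-vanishing smoothings with prescribed support exist.**  For a compact subgroup `Kf` of `G(𝔸_K)`, a non-zero `Kf`-fixed `f ∈ W` and an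
open `U ⊇ Kf`, some continuous compactly supported weight `η ≥ 0`, left-`Kf`-invariant and supported in `U`, gives a non-zero smoothed vector:
take `η` (★ `exists_continuous_invariant_nonneg_pos`) supported in `U ∩ {g | ‖f‖²∕2 < Re ⟪f, R(g) f⟫}`, an open neighbourhood of `Kf` by strong
continuity; then `Re ⟪f, ∫ η(g) R(g) f dν⟫ = ∫ η(g) Re ⟪f, R(g) f⟫ dν ≥ (‖f‖²∕2) ∫ η dν > 0`. [cite: BorelJacquet1979, §4.6] -/
theorem exists_weight_integral_smul_toContRep_ne_zero {Kf : Subgroup 𝒢.Adelic} (hKc : IsCompact (Kf : Set 𝒢.Adelic))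
    {f : W.toSubmodule} (hf : ∀ k ∈ Kf, W.toContRep k f = f) (hf0 : f ≠ 0) {U : Set 𝒢.Adelic} (hUo : IsOpen U)
    (hKU : (Kf : Set 𝒢.Adelic) ⊆ U) :
    ∃ η : 𝒢.Adelic → ℝ, Continuous η ∧ HasCompactSupport η ∧ 0 ≤ η ∧ (∀ k ∈ Kf, ∀ g, η (k * g) = η g) ∧
      Function.support η ⊆ U ∧ (∫ g, (η g : ℂ) • W.toContRep g f ∂ν) ≠ 0 := by
  set F := ((f : W.toSubmodule) : 𝒢.L2 μ) with hF
  have hF0 : F ≠ 0 := fun h => hf0 (Subtype.ext h)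
  have hnorm : 0 < ‖F‖ ^ 2 / 2 := by positivity
  -- the open neighbourhood of `Kf`
  set U' : Set 𝒢.Adelic := U ∩ {g | ‖F‖ ^ 2 / 2 < RCLike.re (inner ℂ F (𝒢.rightRegular μ g F))} with hU'
  have hcont : Continuous fun g => RCLike.re (inner ℂ F (𝒢.rightRegular μ g F)) :=
    RCLike.continuous_re.comp (continuous_const.inner ((𝒢.isStronglyContinuous_rightRegular_holds μ) F))
  have hU'o : IsOpen U' := hUo.inter (isOpen_lt continuous_const hcont)
  have hKU' : (Kf : Set 𝒢.Adelic) ⊆ U' := by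
    intro k hk
    refine ⟨hKU hk, ?_⟩
    have hfix : 𝒢.rightRegular μ k F = F := by
      have h2 := congrArg (fun v : W.toSubmodule => (v : 𝒢.L2 μ)) (hf k hk)
      simp only [ContRepresentation.ClosedSubrep.coe_toContRep_apply] at h2
      exact h2
    change ‖F‖ ^ 2 / 2 < RCLike.re (inner ℂ F (𝒢.rightRegular μ k F))
    rw [hfix, inner_self_eq_norm_sq_to_K]
    norm_cast
    linarith [sq_nonneg ‖F‖]
  obtain ⟨η, hη, hηs, hη0, hηK, hη1, hsupp⟩ := exists_continuous_invariant_nonneg_pos Kf hKc hU'o hKU'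
  refine ⟨η, hη, hηs, hη0, hηK, hsupp.trans Set.inter_subset_left, fun hzero => ?_⟩
  -- `Re ⟪F, smoothed⟫ = ∫ η · Re ⟪F, R g F⟫ ≥ (‖F‖²/2) ∫ η > 0`
  have hint : Integrable (fun g => (η g : ℂ) • 𝒢.rightRegular μ g F) ν :=
    ((Complex.continuous_ofReal.comp hη).smul ((𝒢.isStronglyContinuous_rightRegular_holds μ) F)).integrable_of_hasCompactSupport
      ((hηs.comp_left Complex.ofReal_zero).smul_right)
  have hre : RCLike.re (inner ℂ F (((∫ g, (η g : ℂ) • W.toContRep g f ∂ν : W.toSubmodule) : 𝒢.L2 μ))) =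
      ∫ g, η g * RCLike.re (inner ℂ F (𝒢.rightRegular μ g F)) ∂ν := by
    rw [coe_integral_weight_smul_toContRep 𝒢 ν W hη hηs f, ← hF, ← integral_inner hint]
    have : (fun g => inner ℂ F ((η g : ℂ) • 𝒢.rightRegular μ g F)) = fun g => ((η g : ℂ) * inner ℂ F (𝒢.rightRegular μ g F)) := by
      funext g; rw [inner_smul_right]
    rw [this, ← integral_re (hint.const_inner F |>.congr (Eventually.of_forall fun g => by simp only [inner_smul_right]))]
    congr 1 with g
    exact RCLike.re_ofReal_mul (K := ℂ) (η g) _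
  have hlow : ∀ g, η g * (‖F‖ ^ 2 / 2) ≤ η g * RCLike.re (inner ℂ F (𝒢.rightRegular μ g F)) := by
    intro g
    by_cases hg : η g = 0
    · rw [hg, zero_mul, zero_mul]
    · exact mul_le_mul_of_nonneg_left (le_of_lt (hsupp (Function.mem_support.2 hg)).2) (hη0 g)
  have hi1 : Integrable (fun g => η g * (‖F‖ ^ 2 / 2)) ν := (hη.integrable_of_hasCompactSupport hηs).mul_const _
  have hi2 : Integrable (fun g => η g * RCLike.re (inner ℂ F (𝒢.rightRegular μ g F))) ν :=
    (hη.mul hcont).integrable_of_hasCompactSupport hηs.mul_right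
  have hpos : 0 < ∫ g, η g * (‖F‖ ^ 2 / 2) ∂ν := by
    rw [integral_mul_const]
    exact mul_pos (hη.integral_pos_of_hasCompactSupport_nonneg_nonzero hηs hη0 hη1.ne') hnorm
  have hge := integral_mono hi1 hi2 hlow
  have hzero' : RCLike.re (inner ℂ F (((∫ g, (η g : ℂ) • W.toContRep g f ∂ν : W.toSubmodule) : 𝒢.L2 μ))) = 0 := by
    rw [hzero]; simp
  linarith [hre ▸ hzero']

omit [LocallyCompactSpace 𝒢.Adelic] [SecondCountableTopology 𝒢.Adelic] [MeasurableSpace 𝒢.Adelic] [BorelSpace 𝒢.Adelic]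
  [𝒢.IsAutomorphicMeasure μ] in
/-- A non-zero `L²` class with an a.e. representative `wc` has `wc ≠ 0` (as a function). [folklore] -/
theorem repr_ne_zero_of_ne_zero {w : 𝒢.L2 μ} (hw : w ≠ 0) {wc : 𝒢.automorphicQuotient → ℂ}
    (hwc : (w : 𝒢.automorphicQuotient → ℂ) =ᵐ[μ] wc) : wc ≠ 0 := by
  rintro rfl
  apply hw
  exact Lp.eq_zero_iff_ae_eq_zero.2 hwc

end Summit.HodgeConjecture.HodgeConjecture.Cruxes.HLiu418.K2LiuAutomorphicVectorSmoothing

end
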